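import Summits.QuantumFields.BalabanUV.T4Continuum.Support.NE7PinnedLandauRepT
import Summits.QuantumFields.BalabanUV.T4Continuum.Support.NE7TangentTransportGaugedTopDocked
import HarnessLib

/-!
# NE7PinnedLandauLettersOfLHCI — THE TWO NEW LETTERS OF «REP WITH A FIXED TOP (PG-T)» (F88∕F89's `hProj`, `hR`) REDUCED TO THE GALERKIN LETTERS OF THE TEST CLASS
# `T` (row NE3's E′ letters when `T` is B8's class) PLUS ONE OBJECT: THE «LANDAU-HARMONIC CORNER INTERPOLATION» (LHCI) — for every corner datum `a` a generator `η` with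
# `η(M•w) = a(w)` whose gauge direction `gaugeDir_W η` is Landau against `T`, UNIQUE and with `‖Δ_Wη‖ ≤ C_I·‖a‖∕M²`; file 24

Cell `pub-balaban`, rung (B)+1 sub-cell t4, lineage `b2b-balaban-t4-ne7-p1` (CRUX PROVER NE7 #1 = OWNER of row NE7), generation 77; memo
`t4/b2b-balaban-t4-ne7-p1-g77/GAUGED-TOP-TT.md` §5∕§8.  File F90 (over F87–F89's hypothesis shapes, F80 §1 `sum_hsR_covDiv_add_covLapSite_eq_zero_of_pointedLandau`,
F85 §1 `isPeriodic_corner_gauge`, `NE3.LandauProjectionB8.covLapSite_add ∕ covLapSite_smul`, `gaugeDir_add_fun`).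
WHY (memo §4–§5, §8).  F89 gives the pinned representative modulo three letters by shape: `hProj` (a POINTED generator making `Y + D_Wλ` Landau against the test class `T`),
`hG` (= F83), `hR` (the Petrov–Galerkin sup letter).  THIS FILE shows that `hProj` and `hR` follow from (a) the GALERKIN letters of the class `T` — projection existence, and
the projection with its two sup bounds `‖Δ_Wλ₁‖ ≤ c_R‖F‖`, `‖λ₁‖ ≤ c₀M²c_R‖F‖` (for `T` = B8's class these are row NE3's `LandauProjectionB8` ∕ `LandauProjectionSupCurvedUniform` ∕
`SupRegularityCurvedUniform`; for the DUAL class, their translates) — and (b) ONE new object, the LHCI: `∀ a` (skew, `N`-periodic corner datum) `∃ η` skew periodic with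
`η(M•w) = a(w)`, `gaugeDir_W η` Landau against `T`, `‖Δ_Wη‖_∞ ≤ (C_I∕M²)·‖a‖_∞`, together with its UNIQUENESS (a pointed generator whose Laplacian is `T`-Landau-harmonic
has zero Laplacian) — the flat numerics of memo §4∕§7 (`LHCI sup`, `M²·lap`) are exactly `C_I`-type constants, M-uniform for the dual class.  MECHANISM: `λ := λ₁ + η` with
`η` interpolating `−λ₁∘M•` is pointed and Landau (linearity); uniqueness transfers the bound to EVERY pointed PG solution: `c_R^{PG} = c_R(1 + C_I c₀)`.
WHAT ([folklore]; 0 def, 0 sorry).  §1 `covLapSite_sub'`, `covDiv_zero_dir` (bookkeeping).  §2 **`pinnedProj_of_galerkin_lhci`** — `hProj` from (a)+(b) (existence halves only).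
§3 **`pinnedSupLetter_of_galerkin_lhci`** — `hR` with `c_R(1 + C_I c₀)` from the Galerkin projection-with-bounds, the LHCI-with-bound, and LHCI uniqueness.
HONEST FRAMING (page 1): linear bookkeeping over hypotheses by shape; the Galerkin letters (for the chosen `T`) and the LHCI are NOT proved here; nothing of Bałaban's asserted;
(APE) NOT proved; NOT ONE-STEP, NOT NE7; spine 0∕9; finite T⁴ rung (B)+1 — NOT infinite volume, NOT mass gap, NOT `BetaPertH`, NOT Clay.  Continuum YM on T⁴ ⇐ BetaPertH ∧
nine spine estimates (0/9 proved); BetaPertH ⇐ (D1) ∧ (D4) ∧ CAP+tail; G-an2-4 gates asym, D1 and NE2/3/4.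
-/

set_option autoImplicit false

open NormedSpace
open scoped BigOperators Matrix.Norms.L2Operator
open Finset

namespace Summit.QuantumFields.BalabanUV.T4Continuum.NE7PinnedLandauLettersOfLHCI

open Literature.MathematicalPhysics.QuantumFieldTheory.Balaban1983to89
open B7Prop1Explicit B7Prop2Explicit MatrixLog
open T4AveragingDeficitWall (Ad IsUnitaryCfg IsSkewDir)
open T4AveragingDeficitWallBoundary (IsPeriodicCfg periodBox)
open AveragingDeficitPeriodicCounting (IsPeriodicDir)
open NE3CovariantWeitzenbock (covDiv)
open NE3CovariantCalculus (hsR hsR_add_left)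
open NE3TangentCovariantStructure (gaugeDir_add_fun)
open BlockAveragePushDirGauge (gaugeDir)
open NE3.PairLandauB8 (covLapSite)
open NE3.LandauProjectionB8 (covLapSite_add covLapSite_smul)
open NE7PointedLandauNewtonStep (sum_hsR_covDiv_add_covLapSite_eq_zero_of_pointedLandau)
open NE7TangentTransportGaugedTopDocked (isPeriodic_corner_gauge)

noncomputable section

variable {d : ℕ} {n : Type*} [Fintype n] [DecidableEq n]

/-! ## §1 Bookkeeping -/

/-- `covLapSite` of a pointwise difference. [folklore] -/
theorem covLapSite_sub' (W : Site d → Fin d → (Matrix n n ℂ)ˣ) (lam mu : Site d → Matrix n n ℂ) (y : Site d) :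
    covLapSite W (fun x => lam x - mu x) y = covLapSite W lam y - covLapSite W mu y := by
  have h : (fun x => lam x - mu x) = lam + (-1 : ℝ) • mu := by
    funext x; simp [sub_eq_add_neg]
  rw [h, covLapSite_add, covLapSite_smul]
  simp [sub_eq_add_neg]

/-- `covLapSite` of a pointwise sum. [folklore] -/
theorem covLapSite_add' (W : Site d → Fin d → (Matrix n n ℂ)ˣ) (lam mu : Site d → Matrix n n ℂ) (y : Site d) :
    covLapSite W (fun x => lam x + mu x) y = covLapSite W lam y + covLapSite W mu y := by
  have h : (fun x => lam x + mu x) = lam + mu := rfl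
  rw [h, covLapSite_add]
  rfl

/-- The covariant divergence of the zero direction field vanishes. [folklore] -/
theorem covDiv_zero_dir (W : Site d → Fin d → (Matrix n n ℂ)ˣ) (x : Site d) :
    covDiv W (fun (_ : Site d) (_ : Fin d) => (0 : Matrix n n ℂ)) x = 0 := by
  simp [covDiv, Ad]

/-! ## §2 `hProj` from the Galerkin projection of the class and the LHCI (existence halves) -/

/-- **THE POINTED `T`-LANDAU CORRECTION EXISTS** (F88∕F89's `hProj`) given (a) the Galerkin projection of the class `T` (for every `Y` a generator `λ₁` making `Y + D_Wλ₁`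
Landau against `T` — no membership of `λ₁` in `T` is needed here) and (b) the LHCI existence (for every skew `N`-periodic corner datum `a` a skew periodic `η` with
`η(M•w) = a(w)` whose gauge direction is Landau against `T`): `λ = λ₁ + η` with `a = −λ₁∘M•`. [folklore] -/
theorem pinnedProj_of_galerkin_lhci {L N : ℕ} (j : ℕ) (T : (Site d → Matrix n n ℂ) → Prop) {W : Site d → Fin d → (Matrix n n ℂ)ˣ}
    (hGal : ∀ Y : Site d → Fin d → Matrix n n ℂ, ∃ lam₁ : Site d → Matrix n n ℂ,
      (∀ y, lam₁ y ∈ skewAdjoint (Matrix n n ℂ)) ∧ (∀ (y : Site d) (i : Fin d), lam₁ (y + ((N * L ^ (j + 1) : ℕ) : ℤ) • e i) = lam₁ y) ∧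
      (∀ nu : Site d → Matrix n n ℂ, (∀ y, nu y ∈ skewAdjoint (Matrix n n ℂ)) →
          (∀ (y : Site d) (i : Fin d), nu (y + ((N * L ^ (j + 1) : ℕ) : ℤ) • e i) = nu y) → T nu →
        ∑ y ∈ periodBox (d := d) (N * L ^ (j + 1)), ∑ κ : Fin d, hsR (Y y κ + gaugeDir W lam₁ y κ) (gaugeDir W (covLapSite W nu) y κ) = 0))
    (hI : ∀ a : Site d → Matrix n n ℂ, (∀ w, a w ∈ skewAdjoint (Matrix n n ℂ)) → (∀ (w : Site d) (i : Fin d), a (w + (N : ℤ) • e i) = a w) →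
      ∃ eta : Site d → Matrix n n ℂ,
        (∀ y, eta y ∈ skewAdjoint (Matrix n n ℂ)) ∧ (∀ (y : Site d) (i : Fin d), eta (y + ((N * L ^ (j + 1) : ℕ) : ℤ) • e i) = eta y) ∧
        (∀ w : Site d, eta ((((L ^ (j + 1) : ℕ) : ℤ)) • w) = a w) ∧
        (∀ nu : Site d → Matrix n n ℂ, (∀ y, nu y ∈ skewAdjoint (Matrix n n ℂ)) →
            (∀ (y : Site d) (i : Fin d), nu (y + ((N * L ^ (j + 1) : ℕ) : ℤ) • e i) = nu y) → T nu →
          ∑ y ∈ periodBox (d := d) (N * L ^ (j + 1)), ∑ κ : Fin d, hsR (gaugeDir W eta y κ) (gaugeDir W (covLapSite W nu) y κ) = 0)) :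
    ∀ Y : Site d → Fin d → Matrix n n ℂ, ∃ lam : Site d → Matrix n n ℂ,
      (∀ y, lam y ∈ skewAdjoint (Matrix n n ℂ)) ∧ (∀ (y : Site d) (i : Fin d), lam (y + ((N * L ^ (j + 1) : ℕ) : ℤ) • e i) = lam y) ∧
      (∀ w : Site d, lam ((((L ^ (j + 1) : ℕ) : ℤ)) • w) = 0) ∧
      (∀ nu : Site d → Matrix n n ℂ, (∀ y, nu y ∈ skewAdjoint (Matrix n n ℂ)) →
          (∀ (y : Site d) (i : Fin d), nu (y + ((N * L ^ (j + 1) : ℕ) : ℤ) • e i) = nu y) → T nu →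
        ∑ y ∈ periodBox (d := d) (N * L ^ (j + 1)), ∑ κ : Fin d, hsR (Y y κ + gaugeDir W lam y κ) (gaugeDir W (covLapSite W nu) y κ) = 0) := by
  intro Y
  obtain ⟨lam₁, h1s, h1P, h1L⟩ := hGal Y
  -- the corner datum `a = −λ₁∘M•`: skew and `N`-periodic
  set a : Site d → Matrix n n ℂ := fun w => -lam₁ ((((L ^ (j + 1) : ℕ) : ℤ)) • w) with ha
  have has : ∀ w, a w ∈ skewAdjoint (Matrix n n ℂ) := fun w => (skewAdjoint (Matrix n n ℂ)).neg_mem (h1s _)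
  have haP : ∀ (w : Site d) (i : Fin d), a (w + (N : ℤ) • e i) = a w := fun w i => by
    simp only [ha]
    have := isPeriodic_corner_gauge L N j h1P w i
    push_cast at this ⊢
    rw [this]
  obtain ⟨eta, hes, heP, he0, heL⟩ := hI a has haP
  refine ⟨fun y => lam₁ y + eta y, fun y => (skewAdjoint (Matrix n n ℂ)).add_mem (h1s y) (hes y), fun y i => ?_, fun w => ?_, ?_⟩
  · simp only [h1P y i, heP y i]
  · show lam₁ _ + eta _ = 0
    rw [he0 w]
    simp only [ha, add_neg_cancel]
  · intro nu hnus hnuP hnuT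
    have e1 : ∀ (y : Site d) (κ : Fin d), hsR (Y y κ + gaugeDir W (fun x => lam₁ x + eta x) y κ) (gaugeDir W (covLapSite W nu) y κ)
        = hsR (Y y κ + gaugeDir W lam₁ y κ) (gaugeDir W (covLapSite W nu) y κ) + hsR (gaugeDir W eta y κ) (gaugeDir W (covLapSite W nu) y κ) := by
      intro y κ
      rw [gaugeDir_add_fun, ← add_assoc, hsR_add_left]
    simp_rw [e1, Finset.sum_add_distrib]
    rw [h1L nu hnus hnuP hnuT, heL nu hnus hnuP hnuT, add_zero]

/-! ## §3 `hR` from the Galerkin projection with its sup bounds, the LHCI with its Laplacian bound, and LHCI uniqueness -/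

/-- **THE PETROV–GALERKIN SUP LETTER** (F87–F89's `hR`, with `c_R^{PG} = c_R·(1 + C_I·c₀)`) given (a) the Galerkin projection of the class with its two sup bounds
(`‖Δ_Wλ₁‖ ≤ c_R‖F‖`, `‖λ₁‖ ≤ c₀M²c_R‖F‖`), (b) the LHCI with `‖Δ_Wη‖ ≤ (C_I∕M²)‖a‖`, and (c) its uniqueness (a pointed skew periodic generator whose Laplacian is
`T`-Landau-harmonic has zero Laplacian).  `W` unitary periodic, `N·L^{j+1} ≥ 1`. [folklore] -/
theorem pinnedSupLetter_of_galerkin_lhci {L N : ℕ} (j : ℕ) (hP : 1 ≤ N * L ^ (j + 1)) (T : (Site d → Matrix n n ℂ) → Prop)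
    {W : Site d → Fin d → (Matrix n n ℂ)ˣ} (hWu : IsUnitaryCfg W) (hWP : IsPeriodicCfg W ((N * L ^ (j + 1) : ℕ) : ℤ))
    {c₀ cR CI : ℝ}
    (hGalR : ∀ F : Site d → Matrix n n ℂ, (∀ y, F y ∈ skewAdjoint (Matrix n n ℂ)) →
      (∀ (y : Site d) (i : Fin d), F (y + ((N * L ^ (j + 1) : ℕ) : ℤ) • e i) = F y) →
      ∃ lam₁ : Site d → Matrix n n ℂ,
        (∀ y, lam₁ y ∈ skewAdjoint (Matrix n n ℂ)) ∧ (∀ (y : Site d) (i : Fin d), lam₁ (y + ((N * L ^ (j + 1) : ℕ) : ℤ) • e i) = lam₁ y) ∧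
        (∀ nu : Site d → Matrix n n ℂ, (∀ y, nu y ∈ skewAdjoint (Matrix n n ℂ)) →
            (∀ (y : Site d) (i : Fin d), nu (y + ((N * L ^ (j + 1) : ℕ) : ℤ) • e i) = nu y) → T nu →
          ∑ y ∈ periodBox (d := d) (N * L ^ (j + 1)), hsR (F y + covLapSite W lam₁ y) (covLapSite W nu y) = 0) ∧
        ∀ B : ℝ, (∀ y, ‖F y‖ ≤ B) →
          (∀ y, ‖covLapSite W lam₁ y‖ ≤ cR * B) ∧ (∀ y, ‖lam₁ y‖ ≤ c₀ * ((L : ℝ) ^ (j + 1)) ^ 2 * (cR * B)))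
    (hIR : ∀ a : Site d → Matrix n n ℂ, (∀ w, a w ∈ skewAdjoint (Matrix n n ℂ)) → (∀ (w : Site d) (i : Fin d), a (w + (N : ℤ) • e i) = a w) →
      ∃ eta : Site d → Matrix n n ℂ,
        (∀ y, eta y ∈ skewAdjoint (Matrix n n ℂ)) ∧ (∀ (y : Site d) (i : Fin d), eta (y + ((N * L ^ (j + 1) : ℕ) : ℤ) • e i) = eta y) ∧
        (∀ w : Site d, eta ((((L ^ (j + 1) : ℕ) : ℤ)) • w) = a w) ∧
        (∀ nu : Site d → Matrix n n ℂ, (∀ y, nu y ∈ skewAdjoint (Matrix n n ℂ)) →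
            (∀ (y : Site d) (i : Fin d), nu (y + ((N * L ^ (j + 1) : ℕ) : ℤ) • e i) = nu y) → T nu →
          ∑ y ∈ periodBox (d := d) (N * L ^ (j + 1)), ∑ κ : Fin d, hsR (gaugeDir W eta y κ) (gaugeDir W (covLapSite W nu) y κ) = 0) ∧
        ∀ A : ℝ, (∀ w, ‖a w‖ ≤ A) → ∀ y, ‖covLapSite W eta y‖ ≤ CI / ((L : ℝ) ^ (j + 1)) ^ 2 * A)
    (hUniq : ∀ mu : Site d → Matrix n n ℂ, (∀ y, mu y ∈ skewAdjoint (Matrix n n ℂ)) →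
      (∀ (y : Site d) (i : Fin d), mu (y + ((N * L ^ (j + 1) : ℕ) : ℤ) • e i) = mu y) → (∀ w : Site d, mu ((((L ^ (j + 1) : ℕ) : ℤ)) • w) = 0) →
      (∀ nu : Site d → Matrix n n ℂ, (∀ y, nu y ∈ skewAdjoint (Matrix n n ℂ)) →
          (∀ (y : Site d) (i : Fin d), nu (y + ((N * L ^ (j + 1) : ℕ) : ℤ) • e i) = nu y) → T nu →
        ∑ y ∈ periodBox (d := d) (N * L ^ (j + 1)), hsR (covLapSite W mu y) (covLapSite W nu y) = 0) →
      ∀ y, covLapSite W mu y = 0) :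
    ∀ (F : Site d → Matrix n n ℂ), (∀ y : Site d, F y ∈ skewAdjoint (Matrix n n ℂ)) →
      (∀ (y : Site d) (i : Fin d), F (y + ((N * L ^ (j + 1) : ℕ) : ℤ) • e i) = F y) →
      ∀ mu : Site d → Matrix n n ℂ, ((∀ y, mu y ∈ skewAdjoint (Matrix n n ℂ)) ∧ (∀ (y : Site d) (i : Fin d), mu (y + ((N * L ^ (j + 1) : ℕ) : ℤ) • e i) = mu y) ∧
        (∀ w : Site d, mu ((((L ^ (j + 1) : ℕ) : ℤ)) • w) = 0)) →
        (∀ nu : Site d → Matrix n n ℂ, (∀ y, nu y ∈ skewAdjoint (Matrix n n ℂ)) →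
          (∀ (y : Site d) (i : Fin d), nu (y + ((N * L ^ (j + 1) : ℕ) : ℤ) • e i) = nu y) → T nu →
          ∑ y ∈ periodBox (d := d) (N * L ^ (j + 1)), hsR (F y + covLapSite W mu y) (covLapSite W nu y) = 0) →
        ∀ B : ℝ, (∀ y : Site d, ‖F y‖ ≤ B) → ∀ y : Site d, ‖covLapSite W mu y‖ ≤ (cR * (1 + CI * c₀)) * B := by
  intro F hFs hFP mu hmu horth B hFB y₀
  set M : ℝ := (L : ℝ) ^ (j + 1) with hM
  have hM0 : 0 < M := by
    rw [hM]
    have hL : 0 < L := by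
      rcases Nat.eq_zero_or_pos L with h | h
      · subst h
        rcases Nat.eq_zero_or_pos (j + 1) with h2 | h2
        · omega
        · simp [Nat.zero_pow h2] at hP
      · exact h
    positivity
  have hB0 : 0 ≤ B := (norm_nonneg _).trans (hFB y₀)
  -- (a) the Galerkin solution with its bounds
  obtain ⟨lam₁, h1s, h1P, h1L, h1B⟩ := hGalR F hFs hFP
  obtain ⟨hΔ1, hsup1⟩ := h1B B hFB
  -- (b) the interpolant of `−λ₁∘M•`
  set a : Site d → Matrix n n ℂ := fun w => -lam₁ ((((L ^ (j + 1) : ℕ) : ℤ)) • w) with ha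
  have has : ∀ w, a w ∈ skewAdjoint (Matrix n n ℂ) := fun w => (skewAdjoint (Matrix n n ℂ)).neg_mem (h1s _)
  have haP : ∀ (w : Site d) (i : Fin d), a (w + (N : ℤ) • e i) = a w := fun w i => by
    simp only [ha]
    have := isPeriodic_corner_gauge L N j h1P w i
    push_cast at this ⊢
    rw [this]
  have haA : ∀ w, ‖a w‖ ≤ c₀ * M ^ 2 * (cR * B) := fun w => by
    simp only [ha, norm_neg]; exact hsup1 _
  obtain ⟨eta, hes, heP, he0, heL, heB⟩ := hIR a has haP
  have hΔe : ∀ y, ‖covLapSite W eta y‖ ≤ CI / M ^ 2 * (c₀ * M ^ 2 * (cR * B)) := heB _ haA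
  -- the interpolant's gauge direction is Landau against `T` in the `Δ` form (F80 §1 with `Y = 0`)
  have heL' : ∀ nu : Site d → Matrix n n ℂ, (∀ y, nu y ∈ skewAdjoint (Matrix n n ℂ)) →
      (∀ (y : Site d) (i : Fin d), nu (y + ((N * L ^ (j + 1) : ℕ) : ℤ) • e i) = nu y) → T nu →
      ∑ y ∈ periodBox (d := d) (N * L ^ (j + 1)), hsR (covLapSite W eta y) (covLapSite W nu y) = 0 := by
    intro nu hnus hnuP hnuT
    have hYP : IsPeriodicDir (fun (_ : Site d) (_ : Fin d) => (0 : Matrix n n ℂ)) ((N * L ^ (j + 1) : ℕ) : ℤ) := fun _ _ _ => rfl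
    have h0 : ∑ x ∈ periodBox (d := d) (N * L ^ (j + 1)), ∑ κ : Fin d,
        hsR ((fun (_ : Site d) (_ : Fin d) => (0 : Matrix n n ℂ)) x κ + gaugeDir W eta x κ) (gaugeDir W (covLapSite W nu) x κ) = 0 := by
      simpa only [zero_add] using heL nu hnus hnuP hnuT
    have h := sum_hsR_covDiv_add_covLapSite_eq_zero_of_pointedLandau hP hWu hWP hYP heP hnuP h0
    simpa only [covDiv_zero_dir, zero_add] using h
  -- `λ₂ = λ₁ + η` is a pointed PG solution; `μ − λ₂` is pointed with `T`-Landau-harmonic Laplacian, hence has zero Laplacian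
  set diff : Site d → Matrix n n ℂ := fun x => mu x - (lam₁ x + eta x) with hdiff
  have hds : ∀ y, diff y ∈ skewAdjoint (Matrix n n ℂ) := fun y =>
    (skewAdjoint (Matrix n n ℂ)).sub_mem (hmu.1 y) ((skewAdjoint (Matrix n n ℂ)).add_mem (h1s y) (hes y))
  have hdP : ∀ (y : Site d) (i : Fin d), diff (y + ((N * L ^ (j + 1) : ℕ) : ℤ) • e i) = diff y := fun y i => by
    simp only [hdiff, hmu.2.1 y i, h1P y i, heP y i]
  have hd0 : ∀ w : Site d, diff ((((L ^ (j + 1) : ℕ) : ℤ)) • w) = 0 := fun w => by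
    simp only [hdiff, hmu.2.2 w, he0 w, ha, add_neg_cancel, sub_zero]
  have hΔdiff : ∀ y, covLapSite W diff y = covLapSite W mu y - (covLapSite W lam₁ y + covLapSite W eta y) := fun y => by
    rw [hdiff, covLapSite_sub', covLapSite_add']
  have hdorth : ∀ nu : Site d → Matrix n n ℂ, (∀ y, nu y ∈ skewAdjoint (Matrix n n ℂ)) →
      (∀ (y : Site d) (i : Fin d), nu (y + ((N * L ^ (j + 1) : ℕ) : ℤ) • e i) = nu y) → T nu →
      ∑ y ∈ periodBox (d := d) (N * L ^ (j + 1)), hsR (covLapSite W diff y) (covLapSite W nu y) = 0 := by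
    intro nu hnus hnuP hnuT
    have e1 : ∀ y, hsR (covLapSite W diff y) (covLapSite W nu y)
        = hsR (F y + covLapSite W mu y) (covLapSite W nu y) - hsR (F y + covLapSite W lam₁ y) (covLapSite W nu y)
          - hsR (covLapSite W eta y) (covLapSite W nu y) := by
      intro y
      rw [hΔdiff y]
      have e2 : covLapSite W mu y - (covLapSite W lam₁ y + covLapSite W eta y)
          = (F y + covLapSite W mu y) + (-(F y + covLapSite W lam₁ y)) + (-covLapSite W eta y) := by abel
      rw [e2, hsR_add_left, hsR_add_left, NE3FrameFreeDecompositionPrep.hsR_neg_left, NE3FrameFreeDecompositionPrep.hsR_neg_left]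
      ring
    simp_rw [e1, Finset.sum_sub_distrib]
    rw [horth nu hnus hnuP hnuT, h1L nu hnus hnuP hnuT, heL' nu hnus hnuP hnuT, sub_zero, sub_zero]
  have hzero := hUniq diff hds hdP hd0 hdorth y₀
  -- hence `Δ_W μ = Δ_W λ₁ + Δ_W η` at `y₀`, and the bound
  have hid : covLapSite W mu y₀ = covLapSite W lam₁ y₀ + covLapSite W eta y₀ := by
    have := hΔdiff y₀; rw [hzero] at this; exact (sub_eq_zero.mp this.symm)
  rw [hid]
  have hM2 : M ^ 2 ≠ 0 := by positivity
  calc ‖covLapSite W lam₁ y₀ + covLapSite W eta y₀‖ ≤ ‖covLapSite W lam₁ y₀‖ + ‖covLapSite W eta y₀‖ := norm_add_le _ _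
    _ ≤ cR * B + CI / M ^ 2 * (c₀ * M ^ 2 * (cR * B)) := add_le_add (hΔ1 y₀) (hΔe y₀)
    _ = (cR * (1 + CI * c₀)) * B := by
        have hinv : (M ^ 2)⁻¹ * M ^ 2 = 1 := inv_mul_cancel₀ hM2
        have h : CI / M ^ 2 * (c₀ * M ^ 2 * (cR * B)) = CI * c₀ * (cR * B) := by
          rw [div_eq_mul_inv]
          calc CI * (M ^ 2)⁻¹ * (c₀ * M ^ 2 * (cR * B)) = CI * c₀ * (cR * B) * ((M ^ 2)⁻¹ * M ^ 2) := by ring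
            _ = CI * c₀ * (cR * B) := by rw [hinv, mul_one]
        rw [h]; ring

end

end Summit.QuantumFields.BalabanUV.T4Continuum.NE7PinnedLandauLettersOfLHCI
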